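import Summits.QuantumFields.BalabanUV.Beta.GAN24.ResolventFamilyPolarization
import Literature.MathematicalPhysics.QuantumFieldTheory.Balaban1983to89.Beta.CompositionSingular
import Literature.MathematicalPhysics.QuantumFieldTheory.Balaban1983to89.B5RealFields

/-!
# `BalabanUV.Beta.GAN24.ResolventFamilyRealStructure` — binder row G-an2-4 ∕ (CONV-C), route R7 «TWO CURRENCIES», PART 166: THE REAL STRUCTURE — the one-loop polarization of PART 165
# (a REAL `Family`, pv25's `OneLoop`) EQUALS, after complexification, the `ℂ`-TRACE FORMULA IN THE `ℂ`-TYPED LETTERS of the lineage's towers: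
# `(Π_{ij} : ℂ) = −½·(tr(𝒢·Σ_{ij}) − tr(𝒢·Σ_i·𝒢·Σ_j))` with `𝒢 = CompositionSingular.flucCov Σ₀ Q̃` over `ℂ` and the insertion words over `ℂ`, for EVERY resolvent-form family whose
# `ℂ`-typed letters `D, P_i, Q, Q′, S₀, Q̃` are REAL (`B5RealFields.IsReal`) — the currency in which PARTs 115–163 are written (unit b2b-balaban-gan24-p3, gen 57; v1)

NOT IN PRINT; OUR PROOF ([folklore] bookkeeping: the complexification `A ↦ A.map (↑)` commutes with sums, real multiples, products, transposes, blocks, inverses (via `RingHom.map_det` and the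
right-inverse characterisation `Matrix.inv_eq_right_inv`; both sides `0` at a singular matrix), traces, an5's bordered matrix `Composition.kkt` and an2's `CompositionSingular.flucCov`; PART 165
`ResolventFamilyPolarization.polarization_resolventFamily_eq_trace` BY NAME; b05's `B5RealFields.IsReal ∕ reM ∕ IsReal.map_ofReal_reM` BY NAME.  [Balaban1984PropagatorsI] p. 17 «Field configurations are
real valued functions A defined at bonds of the lattice» and [Balaban1987RG1] (1.20) p. 264 LOCATE the objects; nothing printed is a hypothesis.)
HONEST FRAMING (cell contract, verbatim): «discharging `BetaPertH` makes Bałaban's UV stability UNCONDITIONAL — a real constructive-QFT result; it is NOT the continuum limit and NOT the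
Clay problem.»  HONEST DEPENDENCY (verbatim): «continuum YM on T⁴ ⇐ BetaPertH ∧ nine spine estimates (0/9 proved); BetaPertH ⇐ (D1) ∧ (D4) ∧ CAP+tail; G-an2-4 gates asym, D1 and NE2/3/4.»

WHY (PART 165's located item (c)).  pv25's `Family ∕ polarization` are REAL objects (a Gaussian integral over real fluctuation fields), while road P3's towers — `Δ_a^{(k)} = calDalev`,
`P(V)^{(k)} = Pmodel`, `Q_k`, `c_k`, `Σ_k` — are typed over `ℂ` (the Fourier analysis of B5 lives there; b05's `B5RealFields` records that every such operator is REAL: `isReal_DeltaA`,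
`isReal_fdiff`, `isReal_QvOp`, …, and `VectorPropagatorLimit.coe_calG_re`).  This file is the dictionary between the two: for real letters the complexification of PART 165's real trace
formula IS the same formula read over `ℂ` (§2), so the `Family` built from the real parts `reM` of `ℂ`-typed real letters has `(polarization F i j : ℂ)` equal to the `ℂ`-trace formula in
the ORIGINAL `ℂ`-typed letters (§3) — the shape in which PART 160's `conv_diagramSum_of_tendsto_background` and PART 156's `mul_inputs` consume diagrams.  WHAT REMAINS (unchanged from
PART 165): (a) the letter `𝒢 = flucCov(Σ_k, Q̃)` in the INPUT-triple currency; (b) the loop contraction as a unit-lattice kernel; (c′) the one-line instances `IsReal (calDalev …)`,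
`IsReal (Pmodel V k)` for real `V`, `IsReal (Q_k)` (b05's §2 lemmas composed) — NOT typed here.

WHAT THIS FILE PROVES (0 sorry, 0 `def`; `A.map (↑)` the entrywise complexification `Matrix _ _ ℝ → Matrix _ _ ℂ`):
* §1 (GENERIC) `ofReal_map_mul ∕ _add ∕ _sub ∕ _neg ∕ _smul ∕ _sum ∕ _one ∕ _zero ∕ _transpose ∕ _fromBlocks ∕ _toBlocks₁₁ ∕ _det` (`(det A : ℂ) = det (A.map ↑)`), **`ofReal_map_inv`**
  (`(A⁻¹).map ↑ = (A.map ↑)⁻¹`, no invertibility hypothesis), `ofReal_trace_map`, `ofReal_map_kkt`, **`ofReal_map_flucCov`**, `ofReal_map_pencil`, **`ofReal_map_effFormPencil`**, `isUnit_det_map_iff`.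
* §2 **`ofReal_polarization_resolventFamily`** — for real letters with PART 165's hypotheses (`D`, `c = Q·D⁻¹·Q′`, `K₀` nonsingular):
  `((polarization F i j : ℝ) : ℂ) = −½·((𝒢·Σ_{ij}).trace − (𝒢·Σ_i·𝒢·Σ_j).trace)` with `𝒢 = flucCov ((Q↑·(D↑)⁻¹·Q′↑)⁻¹ + S₀↑) Q̃↑` (an2's `CompositionSingular.flucCov` over `ℂ`) and the words in the
  complexified letters `D↑ = D.map ↑`, ….
* §3 **`ofReal_polarization_of_isReal`** — for `ℂ`-TYPED letters `D, P_i, Q, Q′, S₀, Q̃` with `IsReal` each, `D`, `c`, `K₀` nonsingular over `ℂ`: the REAL family of their real parts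
  `B ↦ (reM Q̃, (reM Q·(reM D + Σ_i B_i•reM P_i)⁻¹·reM Q′)⁻¹ + reM S₀)` has `((polarization F i j : ℝ) : ℂ) = −½·(tr(𝒢·Σ_{ij}) − tr(𝒢·Σ_i·𝒢·Σ_j))` in the ORIGINAL `ℂ`-typed letters.
WHAT IT IS NOT: no limit, no rate, no instance on a specific tower (item (c′)); NOT Bałaban's `Δ^{(k)}(U_{k+1}(exp iB))` (row an1's dictionary).  SUPPLIER work; NEVER «G-an2-4 closed»; NOT (CONV-C),
NOT D1, NOT `BetaPertH`, NOT continuum, NOT Clay.  Records: `HOME/b2b-balaban-gan24-p3/gen57/README.md`.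
-/

noncomputable section

open Matrix
open scoped BigOperators ComplexConjugate

namespace Summit.QuantumFields.BalabanUV.Beta.GAN24.ResolventFamilyRealStructure

open Literature.MathematicalPhysics.QuantumFieldTheory.Balaban1983to89.Beta
open Literature.MathematicalPhysics.QuantumFieldTheory.Balaban1983to89.Beta.Composition (kkt)
open Literature.MathematicalPhysics.QuantumFieldTheory.Balaban1983to89.Beta.CompositionSingular (flucCov)
open Literature.MathematicalPhysics.QuantumFieldTheory.Balaban1983to89.B5RealFields (IsReal reM)
open Summit.QuantumFields.BalabanUV.Beta.GAN24.ResolventFamilyPolarization (polarization_resolventFamily_eq_trace)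

/-! ## §1 Complexification commutes with the algebra of the letters -/

section Complexification

variable {m k l : Type*}

/-- `(A·B)↑ = A↑·B↑`. [folklore] -/
theorem ofReal_map_mul [Fintype k] (A : Matrix m k ℝ) (B : Matrix k l ℝ) :
    (A * B).map ((↑) : ℝ → ℂ) = A.map ((↑) : ℝ → ℂ) * B.map ((↑) : ℝ → ℂ) := by
  ext i j
  simp [Matrix.mul_apply, Complex.ofReal_sum]

/-- `(A + B)↑ = A↑ + B↑`. [folklore] -/
theorem ofReal_map_add (A B : Matrix m k ℝ) : (A + B).map ((↑) : ℝ → ℂ) = A.map ((↑) : ℝ → ℂ) + B.map ((↑) : ℝ → ℂ) := by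
  ext i j; simp

/-- `(A − B)↑ = A↑ − B↑`. [folklore] -/
theorem ofReal_map_sub (A B : Matrix m k ℝ) : (A - B).map ((↑) : ℝ → ℂ) = A.map ((↑) : ℝ → ℂ) - B.map ((↑) : ℝ → ℂ) := by
  ext i j; simp

/-- `(−A)↑ = −A↑`. [folklore] -/
theorem ofReal_map_neg (A : Matrix m k ℝ) : (-A).map ((↑) : ℝ → ℂ) = -A.map ((↑) : ℝ → ℂ) := by
  ext i j; simp

/-- `(r•A)↑ = (r : ℂ)•A↑`. [folklore] -/
theorem ofReal_map_smul (r : ℝ) (A : Matrix m k ℝ) : (r • A).map ((↑) : ℝ → ℂ) = (r : ℂ) • A.map ((↑) : ℝ → ℂ) := by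
  ext i j; simp

/-- `(Σ_s A_s)↑ = Σ_s A_s↑`. [folklore] -/
theorem ofReal_map_sum {ι : Type*} (s : Finset ι) (A : ι → Matrix m k ℝ) :
    (∑ x ∈ s, A x).map ((↑) : ℝ → ℂ) = ∑ x ∈ s, (A x).map ((↑) : ℝ → ℂ) := by
  ext i j
  simp [Matrix.sum_apply, Complex.ofReal_sum]

/-- `1↑ = 1`. [folklore] -/
theorem ofReal_map_one [DecidableEq m] : (1 : Matrix m m ℝ).map ((↑) : ℝ → ℂ) = 1 := by
  ext i j
  simp only [Matrix.map_apply, Matrix.one_apply]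
  split_ifs <;> simp

/-- `0↑ = 0`. [folklore] -/
theorem ofReal_map_zero : (0 : Matrix m k ℝ).map ((↑) : ℝ → ℂ) = 0 := by
  ext i j; simp

/-- `(Aᵀ)↑ = (A↑)ᵀ`. [folklore] -/
theorem ofReal_map_transpose (A : Matrix m k ℝ) : Aᵀ.map ((↑) : ℝ → ℂ) = (A.map ((↑) : ℝ → ℂ))ᵀ := rfl

/-- Complexification of a block matrix, block by block. [folklore] -/
theorem ofReal_map_fromBlocks {o : Type*} (A : Matrix m k ℝ) (B : Matrix m o ℝ) (C : Matrix l k ℝ) (D : Matrix l o ℝ) :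
    (Matrix.fromBlocks A B C D).map ((↑) : ℝ → ℂ)
      = Matrix.fromBlocks (A.map ((↑) : ℝ → ℂ)) (B.map ((↑) : ℝ → ℂ)) (C.map ((↑) : ℝ → ℂ)) (D.map ((↑) : ℝ → ℂ)) :=
  Matrix.fromBlocks_map A B C D _

/-- The upper-left block of the complexification. [folklore] -/
theorem ofReal_map_toBlocks₁₁ {o : Type*} (M : Matrix (m ⊕ l) (k ⊕ o) ℝ) :
    (M.map ((↑) : ℝ → ℂ)).toBlocks₁₁ = M.toBlocks₁₁.map ((↑) : ℝ → ℂ) := rfl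

/-- `(det A : ℂ) = det (A↑)` (Mathlib's `RingHom.map_det` for `Complex.ofRealHom`). [folklore] -/
theorem ofReal_map_det [Fintype m] [DecidableEq m] (A : Matrix m m ℝ) : ((A.det : ℝ) : ℂ) = (A.map ((↑) : ℝ → ℂ)).det :=
  RingHom.map_det Complex.ofRealHom A

/-- Nonsingularity is invariant under complexification. [folklore] -/
theorem isUnit_det_map_iff [Fintype m] [DecidableEq m] (A : Matrix m m ℝ) : IsUnit (A.map ((↑) : ℝ → ℂ)).det ↔ IsUnit A.det := by
  rw [← ofReal_map_det, isUnit_iff_ne_zero, isUnit_iff_ne_zero, Ne, Complex.ofReal_eq_zero]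

/-- **`(A⁻¹)↑ = (A↑)⁻¹`** — complexification commutes with the matrix inverse, with NO invertibility hypothesis (at a singular matrix both sides are `0`). [folklore] -/
theorem ofReal_map_inv [Fintype m] [DecidableEq m] (A : Matrix m m ℝ) : (A⁻¹).map ((↑) : ℝ → ℂ) = (A.map ((↑) : ℝ → ℂ))⁻¹ := by
  by_cases h : IsUnit A.det
  · symm
    apply Matrix.inv_eq_right_inv
    rw [← ofReal_map_mul, Matrix.mul_nonsing_inv A h, ofReal_map_one]
  · have h' : ¬IsUnit (A.map ((↑) : ℝ → ℂ)).det := fun hu => h ((isUnit_det_map_iff A).1 hu)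
    rw [Matrix.nonsing_inv_apply_not_isUnit A h, Matrix.nonsing_inv_apply_not_isUnit _ h', ofReal_map_zero]

/-- `(tr A : ℂ) = tr (A↑)`. [folklore] -/
theorem ofReal_trace_map [Fintype m] (A : Matrix m m ℝ) : ((A.trace : ℝ) : ℂ) = (A.map ((↑) : ℝ → ℂ)).trace := by
  simp [Matrix.trace, Complex.ofReal_sum]

/-- an5's bordered matrix commutes with complexification: `(kkt H Q)↑ = kkt H↑ Q↑`. [folklore] -/
theorem ofReal_map_kkt (H : Matrix m m ℝ) (Q : Matrix k m ℝ) :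
    (kkt H Q).map ((↑) : ℝ → ℂ) = kkt (H.map ((↑) : ℝ → ℂ)) (Q.map ((↑) : ℝ → ℂ)) := by
  unfold kkt
  rw [ofReal_map_fromBlocks, ofReal_map_transpose, ofReal_map_zero]

/-- **an2's fluctuation covariance commutes with complexification: `(flucCov H Q)↑ = flucCov H↑ Q↑`** (`flucCov H Q = ((kkt H Q)⁻¹)₁₁`). [folklore] -/
theorem ofReal_map_flucCov [Fintype m] [DecidableEq m] [Fintype k] [DecidableEq k] (H : Matrix m m ℝ) (Q : Matrix k m ℝ) :
    (flucCov H Q).map ((↑) : ℝ → ℂ) = flucCov (H.map ((↑) : ℝ → ℂ)) (Q.map ((↑) : ℝ → ℂ)) := by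
  unfold flucCov
  rw [← ofReal_map_toBlocks₁₁, ofReal_map_inv, ofReal_map_kkt]

/-- PART 165's `G = ([[Σ₀, Q̃ᵀ],[Q̃, 0]]⁻¹)₁₁` IS an2's `CompositionSingular.flucCov Σ₀ Q̃` (definitional). [folklore] -/
theorem toBlocks₁₁_kktInv_eq_flucCov [Fintype m] [DecidableEq m] [Fintype k] [DecidableEq k] {R : Type*} [Field R] (H : Matrix m m R) (Q : Matrix k m R) :
    ((Matrix.fromBlocks H Qᵀ Q 0)⁻¹).toBlocks₁₁ = flucCov H Q := rfl

end Complexification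

/-! ### The complexified resolvent-form family -/

section Pencil

variable {ι : Type*} [Fintype ι] {p q : Type*} [Fintype p] [DecidableEq p] [Fintype q] [DecidableEq q]

omit [Fintype p] [DecidableEq p] in
/-- `(D + Σ_i B_i•P_i)↑ = D↑ + Σ_i (B_i : ℂ)•P_i↑` for a REAL background `B`. [folklore] -/
theorem ofReal_map_pencil (D : Matrix p p ℝ) (P : ι → Matrix p p ℝ) (B : ι → ℝ) :
    (D + ∑ i, B i • P i).map ((↑) : ℝ → ℂ) = D.map ((↑) : ℝ → ℂ) + ∑ i, ((B i : ℝ) : ℂ) • (P i).map ((↑) : ℝ → ℂ) := by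
  rw [ofReal_map_add, ofReal_map_sum]
  simp only [ofReal_map_smul]

omit [Fintype q] [DecidableEq q] in
/-- The sandwich commutes with complexification: `(Q·R·Q′)↑ = Q↑·R↑·Q′↑` with `R = (D + Σ_i B_i•P_i)⁻¹`. [folklore] -/
theorem ofReal_map_sandwich (D : Matrix p p ℝ) (P : ι → Matrix p p ℝ) (Q : Matrix q p ℝ) (Q' : Matrix p q ℝ) (B : ι → ℝ) :
    (Q * (D + ∑ i, B i • P i)⁻¹ * Q').map ((↑) : ℝ → ℂ)
      = Q.map ((↑) : ℝ → ℂ) * (D.map ((↑) : ℝ → ℂ) + ∑ i, ((B i : ℝ) : ℂ) • (P i).map ((↑) : ℝ → ℂ))⁻¹ * Q'.map ((↑) : ℝ → ℂ) := by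
  rw [ofReal_map_mul, ofReal_map_mul, ofReal_map_inv, ofReal_map_pencil]

/-- **THE EFFECTIVE FORM WITH BACKGROUND COMMUTES WITH COMPLEXIFICATION**: `((Q·(D + Σ_i B_i•P_i)⁻¹·Q′)⁻¹ + S₀)↑ = (Q↑·(D↑ + Σ_i (B_i : ℂ)•P_i↑)⁻¹·Q′↑)⁻¹ + S₀↑`. [folklore] -/
theorem ofReal_map_effFormPencil (D : Matrix p p ℝ) (P : ι → Matrix p p ℝ) (Q : Matrix q p ℝ) (Q' : Matrix p q ℝ) (S₀ : Matrix q q ℝ) (B : ι → ℝ) :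
    ((Q * (D + ∑ i, B i • P i)⁻¹ * Q')⁻¹ + S₀).map ((↑) : ℝ → ℂ)
      = (Q.map ((↑) : ℝ → ℂ) * (D.map ((↑) : ℝ → ℂ) + ∑ i, ((B i : ℝ) : ℂ) • (P i).map ((↑) : ℝ → ℂ))⁻¹ * Q'.map ((↑) : ℝ → ℂ))⁻¹
          + S₀.map ((↑) : ℝ → ℂ) := by
  rw [ofReal_map_add, ofReal_map_inv, ofReal_map_sandwich]

end Pencil

/-! ## §2 The one-loop polarization of PART 165, complexified, is the `ℂ`-trace formula in the complexified letters -/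

section Polarization

variable {ι : Type*} [Fintype ι] [DecidableEq ι] {p : Type*} [Fintype p] [DecidableEq p] {n m : ℕ}

/-- **THE REAL STRUCTURE OF THE ONE-LOOP POLARIZATION OF A RESOLVENT-FORM FAMILY**: for REAL letters `D, P_i, Q, Q′, S₀, Q̃` with `D`, `c = Q·D⁻¹·Q′` and
`K₀ = [[c⁻¹ + S₀, Q̃ᵀ],[Q̃, 0]]` nonsingular, the complexification of pv25's (real) `polarization` of the `Family` `B ↦ (Q̃, (Q·(D + Σ_i B_i•P_i)⁻¹·Q′)⁻¹ + S₀)` is the SAME «½·BUBBLE − ½·TADPOLE»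
trace formula read over `ℂ` in the complexified letters, with an2's `CompositionSingular.flucCov` (over `ℂ`) as the fluctuation covariance — PART 165 `polarization_resolventFamily_eq_trace` pushed through
§1. [folklore] -/
theorem ofReal_polarization_resolventFamily (D : Matrix p p ℝ) (P : ι → Matrix p p ℝ) (Q : Matrix (Fin n) p ℝ) (Q' : Matrix p (Fin n) ℝ)
    (S₀ : Matrix (Fin n) (Fin n) ℝ) (Qc : Matrix (Fin m) (Fin n) ℝ) (hD : IsUnit D.det) (hc : IsUnit (Q * D⁻¹ * Q').det)
    (hK : (Matrix.fromBlocks ((Q * D⁻¹ * Q')⁻¹ + S₀) Qcᵀ Qc 0).det ≠ 0) (i j : ι) :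
    ((polarization (fun B : ι → ℝ => (⟨Qc, (Q * (D + ∑ i, B i • P i)⁻¹ * Q')⁻¹ + S₀⟩ : ConstrainedGaussian n m)) i j : ℝ) : ℂ) =
      -(1 / 2 : ℂ) * ((flucCov ((Q.map ((↑) : ℝ → ℂ) * (D.map ((↑) : ℝ → ℂ))⁻¹ * Q'.map ((↑) : ℝ → ℂ))⁻¹ + S₀.map ((↑) : ℝ → ℂ)) (Qc.map ((↑) : ℝ → ℂ))
            * ((Q.map ((↑) : ℝ → ℂ) * (D.map ((↑) : ℝ → ℂ))⁻¹ * Q'.map ((↑) : ℝ → ℂ))⁻¹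
                * (Q.map ((↑) : ℝ → ℂ) * ((D.map ((↑) : ℝ → ℂ))⁻¹ * (P i).map ((↑) : ℝ → ℂ) * (D.map ((↑) : ℝ → ℂ))⁻¹) * Q'.map ((↑) : ℝ → ℂ))
                * (Q.map ((↑) : ℝ → ℂ) * (D.map ((↑) : ℝ → ℂ))⁻¹ * Q'.map ((↑) : ℝ → ℂ))⁻¹
                * (Q.map ((↑) : ℝ → ℂ) * ((D.map ((↑) : ℝ → ℂ))⁻¹ * (P j).map ((↑) : ℝ → ℂ) * (D.map ((↑) : ℝ → ℂ))⁻¹) * Q'.map ((↑) : ℝ → ℂ))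
                * (Q.map ((↑) : ℝ → ℂ) * (D.map ((↑) : ℝ → ℂ))⁻¹ * Q'.map ((↑) : ℝ → ℂ))⁻¹
              + (Q.map ((↑) : ℝ → ℂ) * (D.map ((↑) : ℝ → ℂ))⁻¹ * Q'.map ((↑) : ℝ → ℂ))⁻¹
                * (Q.map ((↑) : ℝ → ℂ) * ((D.map ((↑) : ℝ → ℂ))⁻¹ * (P j).map ((↑) : ℝ → ℂ) * (D.map ((↑) : ℝ → ℂ))⁻¹) * Q'.map ((↑) : ℝ → ℂ))
                * (Q.map ((↑) : ℝ → ℂ) * (D.map ((↑) : ℝ → ℂ))⁻¹ * Q'.map ((↑) : ℝ → ℂ))⁻¹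
                * (Q.map ((↑) : ℝ → ℂ) * ((D.map ((↑) : ℝ → ℂ))⁻¹ * (P i).map ((↑) : ℝ → ℂ) * (D.map ((↑) : ℝ → ℂ))⁻¹) * Q'.map ((↑) : ℝ → ℂ))
                * (Q.map ((↑) : ℝ → ℂ) * (D.map ((↑) : ℝ → ℂ))⁻¹ * Q'.map ((↑) : ℝ → ℂ))⁻¹
              - (Q.map ((↑) : ℝ → ℂ) * (D.map ((↑) : ℝ → ℂ))⁻¹ * Q'.map ((↑) : ℝ → ℂ))⁻¹
                * (Q.map ((↑) : ℝ → ℂ) * ((D.map ((↑) : ℝ → ℂ))⁻¹ * (P i).map ((↑) : ℝ → ℂ) * (D.map ((↑) : ℝ → ℂ))⁻¹ * (P j).map ((↑) : ℝ → ℂ) * (D.map ((↑) : ℝ → ℂ))⁻¹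
                    + (D.map ((↑) : ℝ → ℂ))⁻¹ * (P j).map ((↑) : ℝ → ℂ) * (D.map ((↑) : ℝ → ℂ))⁻¹ * (P i).map ((↑) : ℝ → ℂ) * (D.map ((↑) : ℝ → ℂ))⁻¹) * Q'.map ((↑) : ℝ → ℂ))
                * (Q.map ((↑) : ℝ → ℂ) * (D.map ((↑) : ℝ → ℂ))⁻¹ * Q'.map ((↑) : ℝ → ℂ))⁻¹)).trace
        - (flucCov ((Q.map ((↑) : ℝ → ℂ) * (D.map ((↑) : ℝ → ℂ))⁻¹ * Q'.map ((↑) : ℝ → ℂ))⁻¹ + S₀.map ((↑) : ℝ → ℂ)) (Qc.map ((↑) : ℝ → ℂ))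
            * ((Q.map ((↑) : ℝ → ℂ) * (D.map ((↑) : ℝ → ℂ))⁻¹ * Q'.map ((↑) : ℝ → ℂ))⁻¹
                * (Q.map ((↑) : ℝ → ℂ) * ((D.map ((↑) : ℝ → ℂ))⁻¹ * (P i).map ((↑) : ℝ → ℂ) * (D.map ((↑) : ℝ → ℂ))⁻¹) * Q'.map ((↑) : ℝ → ℂ))
                * (Q.map ((↑) : ℝ → ℂ) * (D.map ((↑) : ℝ → ℂ))⁻¹ * Q'.map ((↑) : ℝ → ℂ))⁻¹)
            * flucCov ((Q.map ((↑) : ℝ → ℂ) * (D.map ((↑) : ℝ → ℂ))⁻¹ * Q'.map ((↑) : ℝ → ℂ))⁻¹ + S₀.map ((↑) : ℝ → ℂ)) (Qc.map ((↑) : ℝ → ℂ))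
            * ((Q.map ((↑) : ℝ → ℂ) * (D.map ((↑) : ℝ → ℂ))⁻¹ * Q'.map ((↑) : ℝ → ℂ))⁻¹
                * (Q.map ((↑) : ℝ → ℂ) * ((D.map ((↑) : ℝ → ℂ))⁻¹ * (P j).map ((↑) : ℝ → ℂ) * (D.map ((↑) : ℝ → ℂ))⁻¹) * Q'.map ((↑) : ℝ → ℂ))
                * (Q.map ((↑) : ℝ → ℂ) * (D.map ((↑) : ℝ → ℂ))⁻¹ * Q'.map ((↑) : ℝ → ℂ))⁻¹)).trace) := by
  rw [polarization_resolventFamily_eq_trace D P Q Q' S₀ Qc hD hc hK i j, toBlocks₁₁_kktInv_eq_flucCov]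
  simp only [Complex.ofReal_mul, Complex.ofReal_sub, Complex.ofReal_neg, Complex.ofReal_div, Complex.ofReal_one, Complex.ofReal_ofNat, ofReal_trace_map,
    ofReal_map_mul, ofReal_map_add, ofReal_map_sub, ofReal_map_inv, ofReal_map_flucCov]

end Polarization

/-! ## §3 `ℂ`-typed REAL letters: the `Family` of the real parts, its polarization in the original letters -/

section IsRealLetters

variable {ι : Type*} [Fintype ι] [DecidableEq ι] {p : Type*} [Fintype p] [DecidableEq p] {n m : ℕ}

omit [Fintype ι] [DecidableEq ι] [Fintype p] [DecidableEq p] in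
/-- For a REAL `ℂ`-typed matrix, the complexification of its real part is the matrix itself (b05's `IsReal.map_ofReal_reM`, restated with `Matrix.map`). [folklore] -/
theorem reM_map_ofReal {q r : Type*} {A : Matrix q r ℂ} (hA : IsReal A) : (reM A).map ((↑) : ℝ → ℂ) = A :=
  hA.map_ofReal_reM

/-- **THE ONE-LOOP POLARIZATION OF THE REAL FAMILY OF `ℂ`-TYPED REAL LETTERS, IN THE ORIGINAL LETTERS**: for `ℂ`-typed `D, P_i, Q, Q′, S₀, Q̃` with every entry real (`B5RealFields.IsReal`)
and `D`, `c = Q·D⁻¹·Q′`, `K₀ = [[c⁻¹ + S₀, Q̃ᵀ],[Q̃, 0]]` nonsingular (over `ℂ`), the REAL family of the real parts `B ↦ (reM Q̃, (reM Q·(reM D + Σ_i B_i•reM P_i)⁻¹·reM Q′)⁻¹ + reM S₀)` —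
a `Family ι n m` of pv25's `OneLoop` — has
`((polarization F i j : ℝ) : ℂ) = −½·((𝒢·Σ_{ij}).trace − (𝒢·Σ_i·𝒢·Σ_j).trace)`, `𝒢 = flucCov (c⁻¹ + S₀) Q̃`, `Σ_i = c⁻¹X_ic⁻¹`, `Σ_{ij} = c⁻¹X_ic⁻¹X_jc⁻¹ + c⁻¹X_jc⁻¹X_ic⁻¹ − c⁻¹(X_{ij}+X_{ji})c⁻¹`,
`X_i = Q·D⁻¹P_iD⁻¹·Q′`, `X_{ij} = Q·D⁻¹P_iD⁻¹P_jD⁻¹·Q′`, ALL READ OVER `ℂ` IN THE GIVEN LETTERS — the currency of the lineage's towers (PARTs 115–163). [folklore] -/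
theorem ofReal_polarization_of_isReal (D : Matrix p p ℂ) (P : ι → Matrix p p ℂ) (Q : Matrix (Fin n) p ℂ) (Q' : Matrix p (Fin n) ℂ) (S₀ : Matrix (Fin n) (Fin n) ℂ)
    (Qc : Matrix (Fin m) (Fin n) ℂ) (hDr : IsReal D) (hPr : ∀ i, IsReal (P i)) (hQr : IsReal Q) (hQ'r : IsReal Q') (hSr : IsReal S₀) (hQcr : IsReal Qc)
    (hD : IsUnit D.det) (hc : IsUnit (Q * D⁻¹ * Q').det) (hK : (Matrix.fromBlocks ((Q * D⁻¹ * Q')⁻¹ + S₀) Qcᵀ Qc 0).det ≠ 0) (i j : ι) :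
    ((polarization (fun B : ι → ℝ => (⟨reM Qc, (reM Q * (reM D + ∑ i, B i • reM (P i))⁻¹ * reM Q')⁻¹ + reM S₀⟩ : ConstrainedGaussian n m)) i j : ℝ) : ℂ) =
      -(1 / 2 : ℂ) * ((flucCov ((Q * D⁻¹ * Q')⁻¹ + S₀) Qc
            * ((Q * D⁻¹ * Q')⁻¹ * (Q * (D⁻¹ * P i * D⁻¹) * Q') * (Q * D⁻¹ * Q')⁻¹ * (Q * (D⁻¹ * P j * D⁻¹) * Q') * (Q * D⁻¹ * Q')⁻¹
              + (Q * D⁻¹ * Q')⁻¹ * (Q * (D⁻¹ * P j * D⁻¹) * Q') * (Q * D⁻¹ * Q')⁻¹ * (Q * (D⁻¹ * P i * D⁻¹) * Q') * (Q * D⁻¹ * Q')⁻¹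
              - (Q * D⁻¹ * Q')⁻¹ * (Q * (D⁻¹ * P i * D⁻¹ * P j * D⁻¹ + D⁻¹ * P j * D⁻¹ * P i * D⁻¹) * Q') * (Q * D⁻¹ * Q')⁻¹)).trace
        - (flucCov ((Q * D⁻¹ * Q')⁻¹ + S₀) Qc * ((Q * D⁻¹ * Q')⁻¹ * (Q * (D⁻¹ * P i * D⁻¹) * Q') * (Q * D⁻¹ * Q')⁻¹)
            * flucCov ((Q * D⁻¹ * Q')⁻¹ + S₀) Qc * ((Q * D⁻¹ * Q')⁻¹ * (Q * (D⁻¹ * P j * D⁻¹) * Q') * (Q * D⁻¹ * Q')⁻¹)).trace) := by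
  -- the real letters' nonsingularity hypotheses, transported from the `ℂ`-typed ones
  have eD : (reM D).map ((↑) : ℝ → ℂ) = D := reM_map_ofReal hDr
  have eP : ∀ i, (reM (P i)).map ((↑) : ℝ → ℂ) = P i := fun i => reM_map_ofReal (hPr i)
  have eQ : (reM Q).map ((↑) : ℝ → ℂ) = Q := reM_map_ofReal hQr
  have eQ' : (reM Q').map ((↑) : ℝ → ℂ) = Q' := reM_map_ofReal hQ'r
  have eS : (reM S₀).map ((↑) : ℝ → ℂ) = S₀ := reM_map_ofReal hSr
  have eQc : (reM Qc).map ((↑) : ℝ → ℂ) = Qc := reM_map_ofReal hQcr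
  have ec : (reM Q * (reM D)⁻¹ * reM Q').map ((↑) : ℝ → ℂ) = Q * D⁻¹ * Q' := by
    rw [ofReal_map_mul, ofReal_map_mul, ofReal_map_inv, eD, eQ, eQ']
  have eK : (Matrix.fromBlocks ((reM Q * (reM D)⁻¹ * reM Q')⁻¹ + reM S₀) (reM Qc)ᵀ (reM Qc) 0).map ((↑) : ℝ → ℂ)
      = Matrix.fromBlocks ((Q * D⁻¹ * Q')⁻¹ + S₀) Qcᵀ Qc 0 := by
    rw [ofReal_map_fromBlocks, ofReal_map_add, ofReal_map_inv, ec, eS, ofReal_map_transpose, eQc, ofReal_map_zero]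
  have hD' : IsUnit (reM D).det := (isUnit_det_map_iff (reM D)).1 (by rw [eD]; exact hD)
  have hc' : IsUnit (reM Q * (reM D)⁻¹ * reM Q').det := (isUnit_det_map_iff _).1 (by rw [ec]; exact hc)
  have hK' : (Matrix.fromBlocks ((reM Q * (reM D)⁻¹ * reM Q')⁻¹ + reM S₀) (reM Qc)ᵀ (reM Qc) 0).det ≠ 0 := by
    intro h0
    apply hK
    rw [← eK, ← ofReal_map_det, h0, Complex.ofReal_zero]
  rw [ofReal_polarization_resolventFamily (reM D) (fun i => reM (P i)) (reM Q) (reM Q') (reM S₀) (reM Qc) hD' hc' hK' i j, eD, eQ, eQ', eS, eQc, eP i, eP j]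

end IsRealLetters

end Summit.QuantumFields.BalabanUV.Beta.GAN24.ResolventFamilyRealStructure

end
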